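import Literature.MathematicalPhysics.QuantumLattice.FinDimSpectrum
import Literature.MathematicalPhysics.QuantumLattice.TraceInequalitiesProofs
import Literature.MathematicalPhysics.QuantumLattice.DuhamelTwoPoint
import Mathlib.Analysis.Convex.SpecificFunctions.Basic
import Mathlib.Analysis.Real.Sqrt
import HarnessLib

/-!
# The two-time Gibbs correlation bound `|Tr(e^{-(β-τ)H} A e^{-τH} B)| ≤ ‖A‖‖B‖ Tr e^{-βH}` and
boundedness of the finite-temperature Schwinger functions

Topic `MathematicalPhysics/QuantumLattice`; programme under the tree's fact `bgm_two_point_limit`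
(`HubbardFermiLiquid.lean`), continuation of `HubbardSchwingerFunction.lean` (imaginary-time
evolution `A(τ) = e^{τH}Ae^{-τH}`, the time-ordered two-point function `⟨T A(x₀)B(y₀)⟩_β` of
Benfatto–Giuliani–Mastropietro 2006, §1.2 (1.2)–(1.3)). The imaginary-time evolved observable
`A(τ)` is unbounded in `τ`, but inside the Gibbs state the weights recombine,
`Tr(e^{-βH} A(τ) B) = Tr(e^{-(β-τ)H} A e^{-τH} B)`, and for `0 ≤ τ ≤ β` this is bounded by
`‖A‖ ‖B‖ Tr e^{-βH}` — the case `p = β/(β-τ)`, `q = β/τ` of the matrix Hölder inequality, proved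
here directly (eigenbasis of `H`, convexity of `exp`, Cauchy–Schwarz, `|Tr(OP)| ≤ ‖O‖ Tr P`).
Consequences: `|⟨A(τ)B⟩_β| ≤ ‖A‖‖B‖` (`0 ≤ τ ≤ β`), `|⟨T A(x₀)B(y₀)⟩_β| ≤ ‖A‖‖B‖` for
`|x₀ - y₀| ≤ β`, and `|S^{β,L}(𝐱,σ,-;𝐲,σ',+)| ≤ 1` for the Hubbard torus (the last two in the
companion file `HubbardSchwingerFunctionBound.lean`) — uniformly in the volume, the a-priori bound
behind compactness of the Schwinger functions in `L`. Everything is PROVED; no definition is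
introduced.

* `gibbsWeight_eq_conj_diagonal` — `e^{-sH} = U diag(e^{-sλ}) U⋆` (Hermitian functional calculus,
  as in `FinDimSpectrum.partitionFn_eq_sum_exp`); `trace_gibbsWeight_mul_eq_sum`,
  `trace_gibbsWeight_mul_mul_gibbsWeight_mul_eq_sum` — one- and two-time traces in the eigenbasis;
  `re_trace_gibbsWeight_mul_mul_conjTranspose`, `re_trace_gibbsWeight_mul_conjTranspose_mul`,
  `re_trace_gibbsWeight_mul_le`;
* `exp_mul_exp_le_convex` — `e^{-(β-τ)a}e^{-τb} ≤ (1-τ/β)e^{-βa} + (τ/β)e^{-βb}`;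
* **`norm_trace_gibbsWeight_mul_mul_gibbsWeight_mul_le`** — the two-time bound;
  `norm_gibbsState_exp_mul_mul_exp_neg_mul_le` (`|⟨(e^{τH}Ae^{-τH})B⟩_β| ≤ ‖A‖‖B‖`); the corollaries for
  `Matrix.schwingerTwoPoint` / `hubbardSchwingerTwoPoint` are in `HubbardSchwingerFunctionBound.lean`.

## Mathlib / tree search

Mathlib: `Matrix.IsHermitian.cfc_eq`, `Unitary.conjStarAlgAut_apply`, `convexOn_exp`,
`Real.sum_mul_le_sqrt_mul_sqrt`, the scoped `Matrix.Norms.L2Operator` C⋆-norm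
(`Matrix.l2_opNorm_conjTranspose`); no matrix Hölder / two-time Gibbs bound
(`lean search 'holder|Hölder'` in the matrix-trace files: none). Tree: `FinDimSpectrum`
(`gibbsWeight`, `partitionFn_eq_sum_exp`), `TraceInequalitiesProofs`
(`norm_trace_mul_le_opNorm_mul_re_trace`), `DuhamelTwoPoint` (`IsHermitian.partitionFn_eq_ofReal`,
`sum_exp_pos`), `HubbardGaugeBound` (`norm_creation_le_one`, `norm_annihilation_le_one`,
`isHermitian_hamiltonianWith`, used in the companion file).

## References

* O. Bratteli, D. W. Robinson, *Operator Algebras and Quantum Statistical Mechanics II*, 2nd ed.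
  (Springer 1997), §5.3.1 (KMS states: the correlation functions `F_{A,B}(z)` are analytic in
  the strip `0 < Im z < β`, bounded by `‖A‖‖B‖` and continuous on its closure; not held here —
  the finite-dimensional statement below is proved from scratch and tagged folklore).
  [BratteliRobinsonII1997]
* G. Benfatto, A. Giuliani, V. Mastropietro, Ann. Henri Poincaré 7 (2006) 809–898, §1.2
  (1.2)–(1.3). [BenfattoGiulianiMastropietro2006]
-/

noncomputable section

open scoped Matrix.Norms.L2Operator ComplexOrder
open Matrix Finset NormedSpace

namespace Literature.MathematicalPhysics.QuantumLattice

variable {n : Type*} [Fintype n] [DecidableEq n]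

section Spectral

variable {H : Matrix n n ℂ}

/-- The Gibbs weight in the eigenbasis: `e^{-sH} = U diag(e^{-sλᵢ}) U⋆` with the eigenvector
unitary `U` and eigenvalues `λ` of the Hermitian `H` (Hermitian functional calculus).
Bratteli–Robinson II §5.3.1. [folklore] -/
theorem gibbsWeight_eq_conj_diagonal (hH : H.IsHermitian) (s : ℝ) :
    gibbsWeight s H = (hH.eigenvectorUnitary : Matrix n n ℂ) *
      diagonal (fun i => (Real.exp (-s * hH.eigenvalues i) : ℂ)) *
        (star hH.eigenvectorUnitary : Matrix n n ℂ) := by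
  have hsmul : (-(s : ℂ) • H : Matrix n n ℂ) = (-s : ℝ) • H := by
    ext i j
    simp [Matrix.smul_apply, Complex.real_smul]
  have h1 : gibbsWeight s H = cfc (fun x : ℝ => Real.exp ((-s) • x)) H := by
    rw [gibbsWeight, hsmul, cfc_comp_smul (-s) Real.exp H, CFC.real_exp_eq_normedSpace_exp]
  rw [h1, hH.cfc_eq, IsHermitian.cfc, Unitary.conjStarAlgAut_apply]
  congr 2

/-- **Two-time traces in the eigenbasis.** With `A' = U⋆AU`, `B' = U⋆BU`:
`Tr(e^{-sH} A e^{-tH} B) = Σ_{ij} e^{-sλᵢ} A'_{ij} e^{-tλⱼ} B'_{ji}`. [folklore] -/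
theorem trace_gibbsWeight_mul_mul_gibbsWeight_mul_eq_sum (hH : H.IsHermitian) (s t : ℝ)
    (A B : Matrix n n ℂ) :
    (gibbsWeight s H * A * gibbsWeight t H * B).trace =
      ∑ i, ∑ j, (Real.exp (-s * hH.eigenvalues i) : ℂ) *
        ((star hH.eigenvectorUnitary : Matrix n n ℂ) * A * (hH.eigenvectorUnitary : Matrix n n ℂ)) i j *
        (Real.exp (-t * hH.eigenvalues j) : ℂ) *
        ((star hH.eigenvectorUnitary : Matrix n n ℂ) * B * (hH.eigenvectorUnitary : Matrix n n ℂ)) j i := by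
  set U : Matrix n n ℂ := (hH.eigenvectorUnitary : Matrix n n ℂ) with hU
  set Us : Matrix n n ℂ := (star hH.eigenvectorUnitary : Matrix n n ℂ) with hUs
  set Ds : Matrix n n ℂ := diagonal (fun i => (Real.exp (-s * hH.eigenvalues i) : ℂ)) with hDs
  set Dt : Matrix n n ℂ := diagonal (fun i => (Real.exp (-t * hH.eigenvalues i) : ℂ)) with hDt
  rw [gibbsWeight_eq_conj_diagonal hH s, gibbsWeight_eq_conj_diagonal hH t, ← hU, ← hUs, ← hDs, ← hDt]
  have hcyc : (U * Ds * Us * A * (U * Dt * Us) * B).trace = (Ds * (Us * A * U) * Dt * (Us * B * U)).trace := by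
    rw [show U * Ds * Us * A * (U * Dt * Us) * B = U * (Ds * (Us * A * U) * Dt * (Us * B)) by
      simp only [Matrix.mul_assoc], Matrix.trace_mul_comm]
    simp only [Matrix.mul_assoc]
  rw [hcyc, Matrix.trace]
  refine Finset.sum_congr rfl fun i _ => ?_
  rw [Matrix.diag_apply, Matrix.mul_apply]
  refine Finset.sum_congr rfl fun j _ => ?_
  simp only [hDs, hDt, Matrix.mul_diagonal, Matrix.diagonal_mul]

/-- **One-time traces in the eigenbasis**: `Tr(e^{-sH} M) = Σᵢ e^{-sλᵢ} (U⋆MU)ᵢᵢ`. [folklore] -/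
theorem trace_gibbsWeight_mul_eq_sum (hH : H.IsHermitian) (s : ℝ) (M : Matrix n n ℂ) :
    (gibbsWeight s H * M).trace =
      ∑ i, (Real.exp (-s * hH.eigenvalues i) : ℂ) *
        ((star hH.eigenvectorUnitary : Matrix n n ℂ) * M * (hH.eigenvectorUnitary : Matrix n n ℂ)) i i := by
  set U : Matrix n n ℂ := (hH.eigenvectorUnitary : Matrix n n ℂ) with hU
  set Us : Matrix n n ℂ := (star hH.eigenvectorUnitary : Matrix n n ℂ) with hUs
  set Ds : Matrix n n ℂ := diagonal (fun i => (Real.exp (-s * hH.eigenvalues i) : ℂ)) with hDs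
  rw [gibbsWeight_eq_conj_diagonal hH s, ← hU, ← hUs, ← hDs,
    show U * Ds * Us * M = U * (Ds * (Us * M)) by simp only [Matrix.mul_assoc], Matrix.trace_mul_comm,
    show Ds * (Us * M) * U = Ds * (Us * M * U) by simp only [Matrix.mul_assoc], Matrix.trace]
  refine Finset.sum_congr rfl fun i _ => ?_
  rw [Matrix.diag_apply]
  simp only [hDs, Matrix.diagonal_mul]

/-- `U U⋆ = 1` for the eigenvector unitary, adjoint form. [folklore] -/
theorem eigenvectorUnitary_mul_conjTranspose_self (hH : H.IsHermitian) :
    (hH.eigenvectorUnitary : Matrix n n ℂ) * (hH.eigenvectorUnitary : Matrix n n ℂ)ᴴ = 1 := by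
  have := Unitary.coe_mul_star_self hH.eigenvectorUnitary
  rwa [Unitary.coe_star, Matrix.star_eq_conjTranspose] at this

/-- The conjugated matrix of a product with an adjoint: `U⋆(AAᴴ)U = (U⋆AU)(U⋆AU)ᴴ`. [folklore] -/
theorem star_mul_mul_conjTranspose_mul (hH : H.IsHermitian) (A : Matrix n n ℂ) :
    star (hH.eigenvectorUnitary : Matrix n n ℂ) * (A * Aᴴ) * (hH.eigenvectorUnitary : Matrix n n ℂ) =
      (star (hH.eigenvectorUnitary : Matrix n n ℂ) * A * (hH.eigenvectorUnitary : Matrix n n ℂ)) *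
        (star (hH.eigenvectorUnitary : Matrix n n ℂ) * A * (hH.eigenvectorUnitary : Matrix n n ℂ))ᴴ := by
  set U : Matrix n n ℂ := (hH.eigenvectorUnitary : Matrix n n ℂ) with hU
  rw [Matrix.star_eq_conjTranspose, Matrix.conjTranspose_mul, Matrix.conjTranspose_mul,
    Matrix.conjTranspose_conjTranspose,
    show Uᴴ * A * U * (Uᴴ * (Aᴴ * U)) = Uᴴ * A * (U * Uᴴ) * Aᴴ * U by simp only [Matrix.mul_assoc],
    eigenvectorUnitary_mul_conjTranspose_self hH, Matrix.mul_one]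
  simp only [Matrix.mul_assoc]

/-- The conjugated matrix of a product with an adjoint: `U⋆(AᴴA)U = (U⋆AU)ᴴ(U⋆AU)`. [folklore] -/
theorem star_mul_conjTranspose_mul_mul (hH : H.IsHermitian) (A : Matrix n n ℂ) :
    star (hH.eigenvectorUnitary : Matrix n n ℂ) * (Aᴴ * A) * (hH.eigenvectorUnitary : Matrix n n ℂ) =
      (star (hH.eigenvectorUnitary : Matrix n n ℂ) * A * (hH.eigenvectorUnitary : Matrix n n ℂ))ᴴ *
        (star (hH.eigenvectorUnitary : Matrix n n ℂ) * A * (hH.eigenvectorUnitary : Matrix n n ℂ)) := by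
  set U : Matrix n n ℂ := (hH.eigenvectorUnitary : Matrix n n ℂ) with hU
  rw [Matrix.star_eq_conjTranspose, Matrix.conjTranspose_mul, Matrix.conjTranspose_mul,
    Matrix.conjTranspose_conjTranspose,
    show Uᴴ * (Aᴴ * U) * (Uᴴ * A * U) = Uᴴ * Aᴴ * (U * Uᴴ) * A * U by simp only [Matrix.mul_assoc],
    eigenvectorUnitary_mul_conjTranspose_self hH, Matrix.mul_one]
  simp only [Matrix.mul_assoc]

/-- `Re Tr(e^{-βH} A Aᴴ) = Σ_{ij} e^{-βλᵢ} |A'_{ij}|²` with `A' = U⋆AU`. [folklore] -/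
theorem re_trace_gibbsWeight_mul_mul_conjTranspose (hH : H.IsHermitian) (β : ℝ) (A : Matrix n n ℂ) :
    ((gibbsWeight β H * (A * Aᴴ)).trace).re =
      ∑ i, ∑ j, Real.exp (-β * hH.eigenvalues i) *
        ‖((star hH.eigenvectorUnitary : Matrix n n ℂ) * A * (hH.eigenvectorUnitary : Matrix n n ℂ)) i j‖ ^ 2 := by
  rw [trace_gibbsWeight_mul_eq_sum hH, star_mul_mul_conjTranspose_mul hH, Complex.re_sum]
  refine Finset.sum_congr rfl fun i _ => ?_
  rw [Matrix.mul_apply, Finset.mul_sum, Complex.re_sum]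
  refine Finset.sum_congr rfl fun j _ => ?_
  rw [Matrix.conjTranspose_apply, Complex.star_def, Complex.mul_conj, ← Complex.ofReal_mul,
    Complex.ofReal_re, Complex.normSq_eq_norm_sq]

/-- `Re Tr(e^{-βH} Aᴴ A) = Σ_{ij} e^{-βλⱼ} |A'_{ij}|²` with `A' = U⋆AU`. [folklore] -/
theorem re_trace_gibbsWeight_mul_conjTranspose_mul (hH : H.IsHermitian) (β : ℝ) (A : Matrix n n ℂ) :
    ((gibbsWeight β H * (Aᴴ * A)).trace).re =
      ∑ i, ∑ j, Real.exp (-β * hH.eigenvalues j) *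
        ‖((star hH.eigenvectorUnitary : Matrix n n ℂ) * A * (hH.eigenvectorUnitary : Matrix n n ℂ)) i j‖ ^ 2 := by
  rw [trace_gibbsWeight_mul_eq_sum hH, star_mul_conjTranspose_mul_mul hH, Complex.re_sum, Finset.sum_comm]
  refine Finset.sum_congr rfl fun j _ => ?_
  rw [Matrix.mul_apply, Finset.mul_sum, Complex.re_sum]
  refine Finset.sum_congr rfl fun i _ => ?_
  rw [Matrix.conjTranspose_apply, Complex.star_def, mul_comm (starRingEnd ℂ _), Complex.mul_conj,
    ← Complex.ofReal_mul, Complex.ofReal_re, Complex.normSq_eq_norm_sq]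

/-- `Re Tr(e^{-βH} O) ≤ ‖O‖ Re Z` for Hermitian `H`. [folklore] -/
theorem re_trace_gibbsWeight_mul_le (hH : H.IsHermitian) (β : ℝ) (O : Matrix n n ℂ) :
    ((gibbsWeight β H * O).trace).re ≤ ‖O‖ * (partitionFn β H).re := by
  rw [Matrix.trace_mul_comm]
  exact (Complex.re_le_norm _).trans
    (norm_trace_mul_le_opNorm_mul_re_trace O (posDef_gibbsWeight β hH).posSemidef)

/-- The convexity step of the two-time bound: for `0 ≤ τ ≤ β`,
`e^{-(β-τ)a} e^{-τb} ≤ (1 - τ/β) e^{-βa} + (τ/β) e^{-βb}` (convexity of `exp`; for `β = 0` both sides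
are `1`). [folklore] -/
theorem exp_mul_exp_le_convex {β τ : ℝ} (h0 : 0 ≤ τ) (h1 : τ ≤ β) (a b : ℝ) :
    Real.exp (-(β - τ) * a) * Real.exp (-τ * b) ≤
      (1 - τ / β) * Real.exp (-β * a) + τ / β * Real.exp (-β * b) := by
  have hβ : 0 ≤ β := h0.trans h1
  have hθ0 : 0 ≤ τ / β := div_nonneg h0 hβ
  have hθ1 : τ / β ≤ 1 := div_le_one_of_le₀ h1 hβ
  have hθβ : τ / β * β = τ := by
    rcases eq_or_lt_of_le hβ with hb | hb
    · have hτ : τ = 0 := le_antisymm (hb ▸ h1) h0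
      rw [hτ, zero_div, zero_mul]
    · exact div_mul_cancel₀ τ hb.ne'
  have ha : 0 ≤ 1 - τ / β := sub_nonneg.mpr hθ1
  have hab : 1 - τ / β + τ / β = 1 := by ring
  have key := convexOn_exp.2 (Set.mem_univ (-β * a)) (Set.mem_univ (-β * b)) ha hθ0 hab
  simp only [smul_eq_mul] at key
  have hexp : -(β - τ) * a + -τ * b = (1 - τ / β) * (-β * a) + τ / β * (-β * b) := by
    linear_combination (b - a) * hθβ
  rw [← Real.exp_add, hexp]
  exact key

/-- **The two-time Gibbs correlation bound.** For a Hermitian `H`, `0 ≤ τ ≤ β` and all `A`, `B`: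
`|Tr(e^{-(β-τ)H} A e^{-τH} B)| ≤ ‖A‖ ‖B‖ Tr e^{-βH}` (operator norms) — the `p = β/(β-τ)`,
`q = β/τ` case of the matrix Hölder inequality, here by the eigenbasis expansion, convexity of
`exp` and Cauchy–Schwarz. It gives `|⟨A(τ) B⟩_β| ≤ ‖A‖‖B‖` for imaginary-time evolved observables,
`0 ≤ τ ≤ β`, hence boundedness of the finite-temperature Schwinger functions (BGM 2006 §1.2) in
every finite volume, uniformly in the volume. Bratteli–Robinson II §5.3.1 (KMS states; boundedness
of the analytically continued correlation functions on the strip). [folklore] -/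
theorem norm_trace_gibbsWeight_mul_mul_gibbsWeight_mul_le (hH : H.IsHermitian) {β τ : ℝ} (h0 : 0 ≤ τ)
    (h1 : τ ≤ β) (A B : Matrix n n ℂ) :
    ‖(gibbsWeight (β - τ) H * A * gibbsWeight τ H * B).trace‖ ≤ ‖A‖ * ‖B‖ * (partitionFn β H).re := by
  set A' : Matrix n n ℂ := (star hH.eigenvectorUnitary : Matrix n n ℂ) * A *
    (hH.eigenvectorUnitary : Matrix n n ℂ) with hA'
  set B' : Matrix n n ℂ := (star hH.eigenvectorUnitary : Matrix n n ℂ) * B *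
    (hH.eigenvectorUnitary : Matrix n n ℂ) with hB'
  set e : ℝ → n → ℝ := fun s i => Real.exp (-s * hH.eigenvalues i) with he
  have he0 : ∀ s i, 0 ≤ e s i := fun s i => (Real.exp_pos _).le
  -- Step 1: the eigenbasis expansion and the triangle inequality
  have step1 : ‖(gibbsWeight (β - τ) H * A * gibbsWeight τ H * B).trace‖ ≤
      ∑ i, ∑ j, e (β - τ) i * e τ j * (‖A' i j‖ * ‖B' j i‖) := by
    rw [trace_gibbsWeight_mul_mul_gibbsWeight_mul_eq_sum hH, ← hA', ← hB']
    refine (norm_sum_le _ _).trans (Finset.sum_le_sum fun i _ => (norm_sum_le _ _).trans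
      (Finset.sum_le_sum fun j _ => ?_))
    rw [norm_mul, norm_mul, norm_mul, Complex.norm_real, Complex.norm_real,
      Real.norm_of_nonneg (he0 _ _), Real.norm_of_nonneg (he0 _ _)]
    simp only [he]
    nlinarith [he0 (β - τ) i, he0 τ j, norm_nonneg (A' i j), norm_nonneg (B' j i)]
  -- Step 2: convexity, termwise
  have step2 : ∑ i, ∑ j, e (β - τ) i * e τ j * (‖A' i j‖ * ‖B' j i‖) ≤
      (1 - τ / β) * ∑ i, ∑ j, e β i * (‖A' i j‖ * ‖B' j i‖) +
        τ / β * ∑ i, ∑ j, e β j * (‖A' i j‖ * ‖B' j i‖) := by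
    rw [Finset.mul_sum, Finset.mul_sum, ← Finset.sum_add_distrib]
    refine Finset.sum_le_sum fun i _ => ?_
    rw [Finset.mul_sum, Finset.mul_sum, ← Finset.sum_add_distrib]
    refine Finset.sum_le_sum fun j _ => ?_
    have hc : 0 ≤ ‖A' i j‖ * ‖B' j i‖ := by positivity
    have := mul_le_mul_of_nonneg_right (exp_mul_exp_le_convex h0 h1 (hH.eigenvalues i)
      (hH.eigenvalues j)) hc
    simp only [he]
    linarith
  -- Step 3: Cauchy–Schwarz on the two double sums
  have cs : ∀ (w : n → n → ℝ), (∀ i j, 0 ≤ w i j) →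
      ∑ i, ∑ j, w i j * (‖A' i j‖ * ‖B' j i‖) ≤
        Real.sqrt (∑ i, ∑ j, w i j * ‖A' i j‖ ^ 2) * Real.sqrt (∑ i, ∑ j, w i j * ‖B' j i‖ ^ 2) := by
    intro w hw
    have := Real.sum_mul_le_sqrt_mul_sqrt (univ : Finset (n × n))
      (fun p => Real.sqrt (w p.1 p.2) * ‖A' p.1 p.2‖) (fun p => Real.sqrt (w p.1 p.2) * ‖B' p.2 p.1‖)
    simp only [Fintype.sum_prod_type, mul_pow, Real.sq_sqrt (hw _ _)] at this
    refine le_trans (le_of_eq ?_) this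
    refine Finset.sum_congr rfl fun i _ => Finset.sum_congr rfl fun j _ => ?_
    rw [mul_mul_mul_comm, Real.mul_self_sqrt (hw i j)]
  -- Step 4: the four weighted sums are free energies
  have hZ : 0 ≤ (partitionFn β H).re := by
    rw [hH.partitionFn_eq_ofReal, Complex.ofReal_re]
    exact Finset.sum_nonneg fun i _ => (Real.exp_pos _).le
  have nA : ‖A * Aᴴ‖ ≤ ‖A‖ ^ 2 := by
    rw [sq, ← Matrix.l2_opNorm_conjTranspose A, Matrix.l2_opNorm_conjTranspose]
    calc ‖A * Aᴴ‖ ≤ ‖A‖ * ‖Aᴴ‖ := norm_mul_le _ _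
      _ = ‖A‖ * ‖A‖ := by rw [Matrix.l2_opNorm_conjTranspose]
  have nA' : ‖Aᴴ * A‖ ≤ ‖A‖ ^ 2 := by
    calc ‖Aᴴ * A‖ ≤ ‖Aᴴ‖ * ‖A‖ := norm_mul_le _ _
      _ = ‖A‖ ^ 2 := by rw [Matrix.l2_opNorm_conjTranspose, sq]
  have nB : ‖B * Bᴴ‖ ≤ ‖B‖ ^ 2 := by
    calc ‖B * Bᴴ‖ ≤ ‖B‖ * ‖Bᴴ‖ := norm_mul_le _ _
      _ = ‖B‖ ^ 2 := by rw [Matrix.l2_opNorm_conjTranspose, sq]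
  have nB' : ‖Bᴴ * B‖ ≤ ‖B‖ ^ 2 := by
    calc ‖Bᴴ * B‖ ≤ ‖Bᴴ‖ * ‖B‖ := norm_mul_le _ _
      _ = ‖B‖ ^ 2 := by rw [Matrix.l2_opNorm_conjTranspose, sq]
  have t1 : ∑ i, ∑ j, e β i * ‖A' i j‖ ^ 2 ≤ ‖A‖ ^ 2 * (partitionFn β H).re := by
    have h := re_trace_gibbsWeight_mul_le hH β (A * Aᴴ)
    rw [re_trace_gibbsWeight_mul_mul_conjTranspose hH β A, ← hA'] at h
    exact h.trans (mul_le_mul_of_nonneg_right nA hZ)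
  have t2 : ∑ i, ∑ j, e β i * ‖B' j i‖ ^ 2 ≤ ‖B‖ ^ 2 * (partitionFn β H).re := by
    have h := re_trace_gibbsWeight_mul_le hH β (Bᴴ * B)
    rw [re_trace_gibbsWeight_mul_conjTranspose_mul hH β B, ← hB', Finset.sum_comm] at h
    exact h.trans (mul_le_mul_of_nonneg_right nB' hZ)
  have t3 : ∑ i, ∑ j, e β j * ‖A' i j‖ ^ 2 ≤ ‖A‖ ^ 2 * (partitionFn β H).re := by
    have h := re_trace_gibbsWeight_mul_le hH β (Aᴴ * A)
    rw [re_trace_gibbsWeight_mul_conjTranspose_mul hH β A, ← hA'] at h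
    exact h.trans (mul_le_mul_of_nonneg_right nA' hZ)
  have t4 : ∑ i, ∑ j, e β j * ‖B' j i‖ ^ 2 ≤ ‖B‖ ^ 2 * (partitionFn β H).re := by
    have h := re_trace_gibbsWeight_mul_le hH β (B * Bᴴ)
    rw [re_trace_gibbsWeight_mul_mul_conjTranspose hH β B, ← hB', Finset.sum_comm] at h
    exact h.trans (mul_le_mul_of_nonneg_right nB hZ)
  -- Step 5: assemble
  have hθ0 : 0 ≤ τ / β := div_nonneg h0 (h0.trans h1)
  have hθ1 : 0 ≤ 1 - τ / β := sub_nonneg.mpr (div_le_one_of_le₀ h1 (h0.trans h1))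
  have sq_bound : Real.sqrt (‖A‖ ^ 2 * (partitionFn β H).re) * Real.sqrt (‖B‖ ^ 2 * (partitionFn β H).re) =
      ‖A‖ * ‖B‖ * (partitionFn β H).re := by
    rw [Real.sqrt_mul (sq_nonneg _), Real.sqrt_mul (sq_nonneg _), Real.sqrt_sq (norm_nonneg _),
      Real.sqrt_sq (norm_nonneg _), mul_mul_mul_comm, Real.mul_self_sqrt hZ]
  have b1 : ∑ i, ∑ j, e β i * (‖A' i j‖ * ‖B' j i‖) ≤ ‖A‖ * ‖B‖ * (partitionFn β H).re := by
    refine (cs (fun i _ => e β i) fun i _ => he0 β i).trans ?_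
    rw [← sq_bound]
    exact mul_le_mul (Real.sqrt_le_sqrt t1) (Real.sqrt_le_sqrt t2) (Real.sqrt_nonneg _)
      (Real.sqrt_nonneg _)
  have b2 : ∑ i, ∑ j, e β j * (‖A' i j‖ * ‖B' j i‖) ≤ ‖A‖ * ‖B‖ * (partitionFn β H).re := by
    refine (cs (fun _ j => e β j) fun _ j => he0 β j).trans ?_
    rw [← sq_bound]
    exact mul_le_mul (Real.sqrt_le_sqrt t3) (Real.sqrt_le_sqrt t4) (Real.sqrt_nonneg _)
      (Real.sqrt_nonneg _)
  calc ‖(gibbsWeight (β - τ) H * A * gibbsWeight τ H * B).trace‖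
      ≤ ∑ i, ∑ j, e (β - τ) i * e τ j * (‖A' i j‖ * ‖B' j i‖) := step1
    _ ≤ (1 - τ / β) * ∑ i, ∑ j, e β i * (‖A' i j‖ * ‖B' j i‖) +
          τ / β * ∑ i, ∑ j, e β j * (‖A' i j‖ * ‖B' j i‖) := step2
    _ ≤ (1 - τ / β) * (‖A‖ * ‖B‖ * (partitionFn β H).re) + τ / β * (‖A‖ * ‖B‖ * (partitionFn β H).re) :=
          add_le_add (mul_le_mul_of_nonneg_left b1 hθ1) (mul_le_mul_of_nonneg_left b2 hθ0)
    _ = ‖A‖ * ‖B‖ * (partitionFn β H).re := by ring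

/-- **Two-time correlations of the Gibbs state are bounded by the operator norms**: for Hermitian
`H`, `0 ≤ τ ≤ β` and all `A`, `B`, `|⟨(e^{τH} A e^{-τH}) B⟩_β| ≤ ‖A‖ ‖B‖` (the imaginary-time
evolved observable `A(τ)` is unbounded in `τ`, but inside the Gibbs state the weights recombine to
`e^{-(β-τ)H} A e^{-τH} B`). Bratteli–Robinson II §5.3.1. [folklore] -/
theorem norm_gibbsState_exp_mul_mul_exp_neg_mul_le (hH : H.IsHermitian) [Nonempty n] {β τ : ℝ}
    (h0 : 0 ≤ τ) (h1 : τ ≤ β) (A B : Matrix n n ℂ) :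
    ‖gibbsState β H (exp ((τ : ℂ) • H) * A * exp (-((τ : ℂ) • H)) * B)‖ ≤ ‖A‖ * ‖B‖ := by
  have hZre : 0 < (partitionFn β H).re := by
    rw [hH.partitionFn_eq_ofReal, Complex.ofReal_re]; exact hH.sum_exp_pos β
  have hZ : partitionFn β H = ((partitionFn β H).re : ℂ) := by
    rw [hH.partitionFn_eq_ofReal, Complex.ofReal_re]
  -- recombine the weights: `e^{-βH} e^{τH} = e^{-(β-τ)H}`
  have hw : gibbsWeight β H * exp ((τ : ℂ) • H) = gibbsWeight (β - τ) H := by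
    rw [gibbsWeight, gibbsWeight, ← Matrix.exp_add_of_commute _ _
      (((Commute.refl H).smul_left _).smul_right _), ← add_smul]
    congr 1
    push_cast
    ring
  have key := norm_trace_gibbsWeight_mul_mul_gibbsWeight_mul_le hH h0 h1 A B
  rw [gibbsState_apply, show gibbsWeight β H * (exp ((τ : ℂ) • H) * A * exp (-((τ : ℂ) • H)) * B) =
      gibbsWeight β H * exp ((τ : ℂ) • H) * A * gibbsWeight τ H * B by
        simp only [gibbsWeight, neg_smul, Matrix.mul_assoc], hw, norm_mul, norm_inv, hZ,
    Complex.norm_real, Real.norm_of_nonneg hZre.le]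
  rw [hZ, Complex.ofReal_re] at key
  calc ((partitionFn β H).re)⁻¹ * ‖(gibbsWeight (β - τ) H * A * gibbsWeight τ H * B).trace‖
      ≤ ((partitionFn β H).re)⁻¹ * (‖A‖ * ‖B‖ * (partitionFn β H).re) :=
        mul_le_mul_of_nonneg_left key (inv_nonneg.mpr hZre.le)
    _ = ‖A‖ * ‖B‖ := by field_simp

end Spectral

end Literature.MathematicalPhysics.QuantumLattice
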